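import Mathlib
import Summits.Ventures.PercRepro2.HCov
import Summits.Ventures.PercRepro2.HCovSwap
import Summits.Ventures.PercRepro2.OddsLemma
import Summits.Ventures.PercRepro2.J1Regime

/-!
# Row 2′J1-RV — the statement of record (RV) for the non-table content of (J1), typed
(blind cell PercRepro2, typer-1 g9; CONJECTURES row 2′J1-RV, ASSIGNMENTS v12.46 / v12.47)

Marks `(o, a₁, a₂, a₃, b)`, `C_i = C(a_i)`, `Q = {a₁ ↮ a₂}` (`avoidAll ends a₂ {a₁}`), the case-1 world
`T′ = Q ∩ {a₃ ∈ C₁}`, the PD world `PD = Q ∩ {a₃ ∉ C₁ ∪ C₂}` (`PDEvent`), `D = P(PD)`,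
`D_o = P(PD, o ∈ C₁ ∪ C₂)` (`CovForm.Do`), `γ = D_o / D = P(o ∈ C₁ ∪ C₂ ∣ PD)` — NEVER the `C₂`-only
variant (NEG-119: every `o ∈ C₂`-only threshold is false).  The six world masses are
`P(Q)`, `P(Q, b ∈ C₂)`, `P(T′)`, `P(T′, b ∈ C₂)`, `P(T′, o ∈ C₂)`, `P(T′, o ∈ C₂, b ∈ C₂)`.

**(RV)**, form (b) (the required-world form): with `P¹ = P(· ∣ T′)`, `P_Q = P(· ∣ Q)`,
`Cov¹(b ∈ C₂, o ∈ C₂) + (P_Q(b ∈ C₂) − P¹(b ∈ C₂)) · (γ − P¹(o ∈ C₂)) ≥ 0`,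
cleared by `D · P(Q) · P(T′)²` into `rvExpr ≥ 0` (`RV`).  Form (a) (the table form, mine-1's (ii)):
`Cov_μ(1[b ∈ C₂], 1[a₃ ∈ C₁] (1[o ∈ C₂] − γ)) ≥ 0` with `μ = P(· ∣ Q)`, cleared by `D · P(Q)²` into
`rvTableExpr ≥ 0` (`RVTable`) — literally the conclusion of mine-a's regime theorem
(`J1Regime.J1LT_of_regime` with the roots exchanged).  Everything is division-free; the division form
`RVDiv` is recovered under `P(Q), P(T′), D > 0` (`rv_iff_rvDiv`).

Theorems here (all small): `rvExpr_eq` — `rvExpr = P(T′) · rvTableExpr` (a ring identity), hence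
`rv_iff_rvTable` for every probability vector; `dropB_nonneg` / `oddsGap_nonneg` — both factors of the
product term are `≥ 0` (BHK 1.4 `cross_bH_a3L`; the odds lemma `odds_b`), hence `rv_of_cov_nonneg`:
(RV) holds outright wherever the case-1 covariance is `≥ 0`; `rv_of_regime` — (RV) in the pointwise
regime `D · P_{G∖W}(o ∈ C(a₂)) ≤ D_o` for every `W ∋ a₃` (mine-a's `J1LT_of_regime`, mirrored).
Census (lead / mine-a / engine): 0 failures on the exhaustive binary-extreme census at `n = 6`,
`m ≤ 10` (`4 × 24,238,080` instances), `n = 6` full × 3 palettes, `n = 5` full, `n = 7`, `m ≤ 9`; sharp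
(the theta graph: the constant `1` in front of the product cannot be lowered).  No proof of (RV)
beyond the regime is claimed.
-/

namespace Summit.Ventures.PercRepro2

open UnionCluster

namespace J1RV

section Defs

variable {V : Type*} {E : Type*} [Fintype E] [DecidableEq E] {R : Type*} [Field R] [LinearOrder R]

/-- `P(Q)`, `Q = {a₁ ↮ a₂}`. -/
noncomputable def pQ (p : E → R) (ends : E → Sym2 V) (a₁ a₂ : V) : R :=
  prob p (avoidAll ends a₂ {a₁})

/-- `P(Q, b ∈ C₂)`. -/
noncomputable def pQb (p : E → R) (ends : E → Sym2 V) (a₁ a₂ b : V) : R :=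
  prob p (avoidAll ends a₂ {a₁} ∩ connEvent ends a₂ b)

/-- `P(T′) = P(Q, a₃ ∈ C₁)`: the mass of the case-1 world. -/
noncomputable def pT1 (p : E → R) (ends : E → Sym2 V) (a₁ a₂ a₃ : V) : R :=
  prob p (avoidAll ends a₂ {a₁} ∩ connEvent ends a₁ a₃)

/-- `P(T′, b ∈ C₂)`. -/
noncomputable def pT1b (p : E → R) (ends : E → Sym2 V) (a₁ a₂ a₃ b : V) : R :=
  prob p (avoidAll ends a₂ {a₁} ∩ connEvent ends a₁ a₃ ∩ connEvent ends a₂ b)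

/-- `P(T′, o ∈ C₂)`. -/
noncomputable def pT1o (p : E → R) (ends : E → Sym2 V) (o a₁ a₂ a₃ : V) : R :=
  prob p (avoidAll ends a₂ {a₁} ∩ connEvent ends a₁ a₃ ∩ connEvent ends a₂ o)

/-- `P(T′, o ∈ C₂, b ∈ C₂)`. -/
noncomputable def pT1ob (p : E → R) (ends : E → Sym2 V) (o a₁ a₂ a₃ b : V) : R :=
  prob p (avoidAll ends a₂ {a₁} ∩ connEvent ends a₁ a₃ ∩ connEvent ends a₂ o ∩ connEvent ends a₂ b)

/-- **Form (a) cleared by `D · P(Q)²`**: `rvTableExpr = D · P(Q)² · Cov_μ(1[b ∈ C₂], 1[a₃ ∈ C₁] (1[o ∈ C₂] − γ))`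
with `μ = P(· ∣ Q)`, i.e. `P(Q)·(D·P(T′,oH,bH) − D_o·P(T′,bH)) − P(Q,bH)·(D·P(T′,oH) − D_o·P(T′))`. -/
noncomputable def rvTableExpr (p : E → R) (ends : E → Sym2 V) (o a₁ a₂ a₃ b : V) : R :=
  pQ p ends a₁ a₂ *
      (prob p (PDEvent ends a₁ a₂ a₃) * pT1ob p ends o a₁ a₂ a₃ b -
        CovForm.Do p ends o a₁ a₂ a₃ * pT1b p ends a₁ a₂ a₃ b) -
    pQb p ends a₁ a₂ b *
      (prob p (PDEvent ends a₁ a₂ a₃) * pT1o p ends o a₁ a₂ a₃ -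
        CovForm.Do p ends o a₁ a₂ a₃ * pT1 p ends a₁ a₂ a₃)

/-- **(RV), table form (a)** — mine-1's (ii) of the Z-split:
`Cov_μ(1[b ∈ C₂], 1[a₃ ∈ C₁] (1[o ∈ C₂] − γ)) ≥ 0`, cleared. -/
def RVTable (p : E → R) (ends : E → Sym2 V) (o a₁ a₂ a₃ b : V) : Prop :=
  0 ≤ rvTableExpr p ends o a₁ a₂ a₃ b

/-- **Form (b) cleared by `D · P(Q) · P(T′)²`**: the case-1 covariance
`P(Q)·D·(P(T′,oH,bH)·P(T′) − P(T′,oH)·P(T′,bH))` plus the product of the cleared drops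
`(P(Q,bH)·P(T′) − P(T′,bH)·P(Q)) · (D_o·P(T′) − D·P(T′,oH))`. -/
noncomputable def rvExpr (p : E → R) (ends : E → Sym2 V) (o a₁ a₂ a₃ b : V) : R :=
  pQ p ends a₁ a₂ * prob p (PDEvent ends a₁ a₂ a₃) *
      (pT1ob p ends o a₁ a₂ a₃ b * pT1 p ends a₁ a₂ a₃ -
        pT1o p ends o a₁ a₂ a₃ * pT1b p ends a₁ a₂ a₃ b) +
    (pQb p ends a₁ a₂ b * pT1 p ends a₁ a₂ a₃ - pT1b p ends a₁ a₂ a₃ b * pQ p ends a₁ a₂) *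
      (CovForm.Do p ends o a₁ a₂ a₃ * pT1 p ends a₁ a₂ a₃ -
        prob p (PDEvent ends a₁ a₂ a₃) * pT1o p ends o a₁ a₂ a₃)

/-- **(RV) — row 2′J1-RV, the statement of record**, required-world form (b):
`Cov¹(b ∈ C₂, o ∈ C₂) + (P_Q(b ∈ C₂) − P¹(b ∈ C₂)) · (γ − P¹(o ∈ C₂)) ≥ 0`, cleared by `D · P(Q) · P(T′)²`
(`P¹ = P(· ∣ T′)`, `γ = P(o ∈ C₁ ∪ C₂ ∣ PD)`).  A definition only: census-true (exhaustive
binary-extreme `n = 6`, `m ≤ 10`; `n = 6` full; `n = 7`, `m ≤ 9`), sharp, not proved beyond the regime. -/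
def RV (p : E → R) (ends : E → Sym2 V) (o a₁ a₂ a₃ b : V) : Prop :=
  0 ≤ rvExpr p ends o a₁ a₂ a₃ b

omit [LinearOrder R] in
/-- **The two cleared forms agree up to the case-1 mass**: `rvExpr = P(T′) · rvTableExpr`
(a ring identity: the cross terms `P(Q)·D·P(T′,oH)·P(T′,bH)` cancel). -/
theorem rvExpr_eq (p : E → R) (ends : E → Sym2 V) (o a₁ a₂ a₃ b : V) :
    rvExpr p ends o a₁ a₂ a₃ b = pT1 p ends a₁ a₂ a₃ * rvTableExpr p ends o a₁ a₂ a₃ b := by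
  unfold rvExpr rvTableExpr
  ring

omit [LinearOrder R] in
/-- `P(T′)` in the vocabulary of `HCov.lean`: `T′ = TEvent ends a₂ a₁ a₃`. -/
theorem pT1_eq_TEvent (p : E → R) (ends : E → Sym2 V) (a₁ a₂ a₃ : V) :
    pT1 p ends a₁ a₂ a₃ = prob p (TEvent ends a₂ a₁ a₃) := by
  unfold pT1
  rw [CovForm.TEvent_swap_eq]

end Defs

section Order

variable {V : Type*} {E : Type*} [Fintype E] [DecidableEq E] {R : Type*} [Field R] [LinearOrder R]
  [IsStrictOrderedRing R]

/-- The table form implies the required-world form (`P(T′) ≥ 0`). -/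
theorem rv_of_rvTable (p : E → R) (hp : IsProbVec p) (ends : E → Sym2 V) (o a₁ a₂ a₃ b : V)
    (h : RVTable p ends o a₁ a₂ a₃ b) : RV p ends o a₁ a₂ a₃ b := by
  unfold RV
  rw [rvExpr_eq]
  exact mul_nonneg (prob_nonneg hp _) h

/-- The required-world form implies the table form: divide by `P(T′) > 0`, and when `P(T′) = 0`
every case-1 mass vanishes and both sides are `0`. -/
theorem rvTable_of_rv (p : E → R) (hp : IsProbVec p) (ends : E → Sym2 V) (o a₁ a₂ a₃ b : V)
    (h : RV p ends o a₁ a₂ a₃ b) : RVTable p ends o a₁ a₂ a₃ b := by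
  unfold RV at h
  rw [rvExpr_eq] at h
  rcases (prob_nonneg hp (avoidAll ends a₂ {a₁} ∩ connEvent ends a₁ a₃)).lt_or_eq with hT | hT
  · exact nonneg_of_mul_nonneg_right h hT
  · -- `P(T′) = 0`: the three finer case-1 masses are squeezed to `0`
    have hT0 : pT1 p ends a₁ a₂ a₃ = 0 := hT.symm
    have hb : pT1b p ends a₁ a₂ a₃ b = 0 :=
      le_antisymm (hT ▸ prob_inter_le_left hp _ _) (prob_nonneg hp _)
    have ho : pT1o p ends o a₁ a₂ a₃ = 0 :=
      le_antisymm (hT ▸ prob_inter_le_left hp _ _) (prob_nonneg hp _)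
    have hob : pT1ob p ends o a₁ a₂ a₃ b = 0 := by
      refine le_antisymm ?_ (prob_nonneg hp _)
      refine le_trans (prob_inter_le_left hp _ _) ?_
      exact hT ▸ prob_inter_le_left hp _ _
    unfold RVTable rvTableExpr
    rw [hT0, hb, ho, hob]
    simp

/-- **(RV) ⟺ (RV) in table form**, for every probability vector. -/
theorem rv_iff_rvTable (p : E → R) (hp : IsProbVec p) (ends : E → Sym2 V) (o a₁ a₂ a₃ b : V) :
    RV p ends o a₁ a₂ a₃ b ↔ RVTable p ends o a₁ a₂ a₃ b :=
  ⟨rvTable_of_rv p hp ends o a₁ a₂ a₃ b, rv_of_rvTable p hp ends o a₁ a₂ a₃ b⟩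

end Order

section Signs

variable {V : Type*} {E : Type*} [Fintype E] [DecidableEq E] [Fintype V] [DecidableEq V]
  {R : Type*} [Field R] [LinearOrder R] [IsStrictOrderedRing R]

/-- **The `b`-drop is `≥ 0`** (cleared): `P(Q, b ∈ C₂) · P(T′) − P(T′, b ∈ C₂) · P(Q) ≥ 0`, i.e.
`P(b ∈ C₂ ∣ T′) ≤ P(b ∈ C₂ ∣ Q)` — BHK 1.4 (`cross_bH_a3L`). -/
theorem dropB_nonneg (p : E → R) (hp : IsProbVec p) (ends : E → Sym2 V) (a₁ a₂ a₃ b : V) :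
    0 ≤ pQb p ends a₁ a₂ b * pT1 p ends a₁ a₂ a₃ - pT1b p ends a₁ a₂ a₃ b * pQ p ends a₁ a₂ := by
  have h := CovForm.cross_bH_a3L p hp ends a₁ a₂ a₃ b
  rw [CovForm.TEvent_swap_eq] at h
  unfold pQb pT1 pT1b pQ
  linarith

/-- **The odds gap is `≥ 0`** (cleared): `D_o · P(T′) − D · P(T′, o ∈ C₂) ≥ 0`, i.e.
`P(o ∈ C₂ ∣ T′) ≤ γ` — the two-mark odds lemma (`odds_b`). -/
theorem oddsGap_nonneg (p : E → R) (hp : IsProbVec p) (ends : E → Sym2 V) (o a₁ a₂ a₃ : V) :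
    0 ≤ CovForm.Do p ends o a₁ a₂ a₃ * pT1 p ends a₁ a₂ a₃ -
      prob p (PDEvent ends a₁ a₂ a₃) * pT1o p ends o a₁ a₂ a₃ := by
  have h := CovForm.odds_b p hp ends o a₁ a₂ a₃
  rw [CovForm.TEvent_swap_eq] at h
  unfold pT1 pT1o
  linarith

/-- **(RV) holds wherever the case-1 covariance is `≥ 0`**: the product term is a product of two
nonnegative factors (`dropB_nonneg`, `oddsGap_nonneg`), so the whole content of (RV) sits on the
instances with `Cov¹(b ∈ C₂, o ∈ C₂) < 0`. -/
theorem rv_of_cov_nonneg (p : E → R) (hp : IsProbVec p) (ends : E → Sym2 V) (o a₁ a₂ a₃ b : V)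
    (hcov : 0 ≤ pT1ob p ends o a₁ a₂ a₃ b * pT1 p ends a₁ a₂ a₃ -
      pT1o p ends o a₁ a₂ a₃ * pT1b p ends a₁ a₂ a₃ b) :
    RV p ends o a₁ a₂ a₃ b := by
  unfold RV rvExpr
  have h1 := dropB_nonneg p hp ends a₁ a₂ a₃ b
  have h2 := oddsGap_nonneg p hp ends o a₁ a₂ a₃
  have hQ : 0 ≤ pQ p ends a₁ a₂ := prob_nonneg hp _
  have hD : 0 ≤ prob p (PDEvent ends a₁ a₂ a₃) := prob_nonneg hp _
  have := mul_nonneg (mul_nonneg hQ hD) hcov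
  have := mul_nonneg h1 h2
  linarith

end Signs

section Div

variable {V : Type*} {E : Type*} [Fintype E] [DecidableEq E] {R : Type*} [Field R] [LinearOrder R]
  [IsStrictOrderedRing R]

/-- `Cov¹(b ∈ C₂, o ∈ C₂) = P¹(oH, bH) − P¹(oH) · P¹(bH)`, `P¹ = P(· ∣ T′)` (division form). -/
noncomputable def covOne (p : E → R) (ends : E → Sym2 V) (o a₁ a₂ a₃ b : V) : R :=
  pT1ob p ends o a₁ a₂ a₃ b / pT1 p ends a₁ a₂ a₃ -
    (pT1o p ends o a₁ a₂ a₃ / pT1 p ends a₁ a₂ a₃) * (pT1b p ends a₁ a₂ a₃ b / pT1 p ends a₁ a₂ a₃)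

/-- The `b`-drop `P(b ∈ C₂ ∣ Q) − P(b ∈ C₂ ∣ T′)` (division form). -/
noncomputable def dropB (p : E → R) (ends : E → Sym2 V) (a₁ a₂ a₃ b : V) : R :=
  pQb p ends a₁ a₂ b / pQ p ends a₁ a₂ - pT1b p ends a₁ a₂ a₃ b / pT1 p ends a₁ a₂ a₃

/-- `γ = D_o / D = P(o ∈ C₁ ∪ C₂ ∣ PD)` — the PD-odds of `o ∈ U` (`D_o = CovForm.Do` counts `o ∈ C₁` and
`o ∈ C₂`; the `C₂`-only variant is NOT this quantity). -/
noncomputable def gamma (p : E → R) (ends : E → Sym2 V) (o a₁ a₂ a₃ : V) : R :=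
  CovForm.Do p ends o a₁ a₂ a₃ / prob p (PDEvent ends a₁ a₂ a₃)

/-- `P¹(o ∈ C₂) = P(T′, o ∈ C₂) / P(T′)` (division form). -/
noncomputable def oOne (p : E → R) (ends : E → Sym2 V) (o a₁ a₂ a₃ : V) : R :=
  pT1o p ends o a₁ a₂ a₃ / pT1 p ends a₁ a₂ a₃

/-- **(RV) in division form**: `Cov¹(b ∈ C₂, o ∈ C₂) + (P_Q(b ∈ C₂) − P¹(b ∈ C₂)) · (γ − P¹(o ∈ C₂)) ≥ 0`
(meaningful when `P(Q), P(T′), D > 0`; see `rv_iff_rvDiv`). -/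
def RVDiv (p : E → R) (ends : E → Sym2 V) (o a₁ a₂ a₃ b : V) : Prop :=
  0 ≤ covOne p ends o a₁ a₂ a₃ b +
    dropB p ends a₁ a₂ a₃ b * (gamma p ends o a₁ a₂ a₃ - oOne p ends o a₁ a₂ a₃)

omit [LinearOrder R] [IsStrictOrderedRing R] in
/-- The clearing identity: `rvExpr = P(Q) · D · P(T′)² · (Cov¹ + drop_b · (γ − P¹(o)))` when the three
denominators are nonzero. -/
theorem rvExpr_eq_div (p : E → R) (ends : E → Sym2 V) (o a₁ a₂ a₃ b : V)
    (hQ : pQ p ends a₁ a₂ ≠ 0) (hT : pT1 p ends a₁ a₂ a₃ ≠ 0)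
    (hD : prob p (PDEvent ends a₁ a₂ a₃) ≠ 0) :
    rvExpr p ends o a₁ a₂ a₃ b =
      pQ p ends a₁ a₂ * prob p (PDEvent ends a₁ a₂ a₃) * pT1 p ends a₁ a₂ a₃ ^ 2 *
        (covOne p ends o a₁ a₂ a₃ b +
          dropB p ends a₁ a₂ a₃ b * (gamma p ends o a₁ a₂ a₃ - oOne p ends o a₁ a₂ a₃)) := by
  unfold rvExpr covOne dropB gamma oOne
  field_simp

/-- **(RV) ⟺ its division form** whenever `P(Q)`, `P(T′)` and `D` are positive. -/
theorem rv_iff_rvDiv (p : E → R) (ends : E → Sym2 V) (o a₁ a₂ a₃ b : V)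
    (hQ : 0 < pQ p ends a₁ a₂) (hT : 0 < pT1 p ends a₁ a₂ a₃)
    (hD : 0 < prob p (PDEvent ends a₁ a₂ a₃)) :
    RV p ends o a₁ a₂ a₃ b ↔ RVDiv p ends o a₁ a₂ a₃ b := by
  unfold RV RVDiv
  rw [rvExpr_eq_div p ends o a₁ a₂ a₃ b hQ.ne' hT.ne' hD.ne']
  exact mul_nonneg_iff_of_pos_left (mul_pos (mul_pos hQ hD) (pow_pos hT 2))

end Div

section Regime

variable {V : Type*} {E : Type*} [Fintype E] [DecidableEq E] [Fintype V] [DecidableEq V]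
  {R : Type*} [Field R] [LinearOrder R] [IsStrictOrderedRing R]

/-- **(RV), table form, in the pointwise regime**: if `D · P_{G∖W}(o ∈ C(a₂)) ≤ D_o` for every `W ∋ a₃`
(every host of `a₃` has `o`-odds at most `γ`), then `RVTable` — mine-a's `J1LT_of_regime` with the two
roots exchanged (`avoidAll_root_swap`, `PDEvent_root_swap`, `Do_root_swap`). -/
theorem rvTable_of_regime (p : E → R) (hp : IsProbVec p) (ends : E → Sym2 V) (o a₁ a₂ a₃ b : V)
    (hreg : ∀ W : Set V, a₃ ∈ W →
      prob p (PDEvent ends a₁ a₂ a₃) * delClusterProb p ends a₂ {W : Set V | o ∈ W} W ≤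
        CovForm.Do p ends o a₁ a₂ a₃) :
    RVTable p ends o a₁ a₂ a₃ b := by
  have h := J1Regime.J1LT_of_regime p ends o a₂ a₁ a₃ b hp (by
    intro W hW
    rw [CovForm.PDEvent_root_swap ends a₁ a₂ a₃, CovForm.Do_root_swap p ends o a₁ a₂ a₃]
    exact hreg W hW)
  rw [CovForm.avoidAll_root_swap ends a₁ a₂, CovForm.PDEvent_root_swap ends a₁ a₂ a₃,
    CovForm.Do_root_swap p ends o a₁ a₂ a₃] at h
  unfold RVTable rvTableExpr pQ pQb pT1 pT1b pT1o pT1ob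
  linarith

/-- **(RV) in the pointwise regime** (`rvTable_of_regime` + `rv_of_rvTable`). -/
theorem rv_of_regime (p : E → R) (hp : IsProbVec p) (ends : E → Sym2 V) (o a₁ a₂ a₃ b : V)
    (hreg : ∀ W : Set V, a₃ ∈ W →
      prob p (PDEvent ends a₁ a₂ a₃) * delClusterProb p ends a₂ {W : Set V | o ∈ W} W ≤
        CovForm.Do p ends o a₁ a₂ a₃) :
    RV p ends o a₁ a₂ a₃ b :=
  rv_of_rvTable p hp ends o a₁ a₂ a₃ b (rvTable_of_regime p hp ends o a₁ a₂ a₃ b hreg)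

end Regime

end J1RV

end Summit.Ventures.PercRepro2
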